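import Summits.HubbardSuperconductivity.HubbardSuperconductivity.Theorems.NodalDiracTwistNodalDiracWeakCouplingAnnulusInvariance
import Summits.HubbardSuperconductivity.HubbardSuperconductivity.Theorems.NodalDiracTwistBridgeNodalToDWaveDiagonalParityFlipLoop

/-!
# Route `NodalDiracTwist` — crux `NodalDiracWeakCoupling`, line `birth`: `stub_meshCoarsening`

Helper file for stmt-HubbardSuperconductivity-10370 (`NodalDiracWeakCoupling`): the stub
`stub_meshCoarsening` of the line `birth` (skeleton v8) — mesh independence of the lattice `ℤ₂`
holonomy on a circle. For the spin-twisted torus `H_L(U, φ) = spinTwistedHubbardTorus L U φ`: if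
the `(N, S^z = 0)`-sector ground state is unique up to scalars at every point of the CIRCLE
`|φ - p| = r` (`r > 0`), there is `n₀` such that for all `n ≥ n₀` and all `k ≥ 1`, negativity of
the real part of the cyclic overlap products of all unit ground-state choices on the `kn`-gon
`p + r (cos 2πi/kn, sin 2πi/kn)` implies the same on the `n`-gon.

The abstract form `re_prod_cyclicOverlap_neg_of_refinement` follows
`re_prod_cyclicOverlap_neg_of_annulus` (`…AnnulusInvariance`): `T`-real unit sections
(`exists_unit_groundState_fixed`) make all link variables real, `uniform_overlap_of_isCompact` on
the compact circle makes links of vertices at sup-distance `< δ` close to `±1`, for `n ≥ n₀` the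
`k + 1` fine vertices of the block between two consecutive coarse vertices are pairwise `δ`-close,
so the coarse link of a block has the sign of the product of its `k` fine links (`prod_fan_pos`, a
fan of thin triangles, `triangle_re_pos`); hence the coarse real loop product has the sign of the
fine one (`prod_range_mul_eq_prod_prod`), negative by hypothesis applied to the sections; unit
choices on the `n`-gon differ from the sections by unimodular phases, which cancel cyclically
(`prod_star_smul_dotProduct_smul`). The model inputs (continuity, the antiunitary `T v = F v̄`, `F`
the spin-exchange unitary, the coordinate description of `szSector N 0`, the empty-sector branch)
are those of `annulusInvariance_twisted`.

## References

T. Fukui, Y. Hatsugai, H. Suzuki, J. Phys. Soc. Jpn. 74 (2005) 1674 (lattice link variables, gauge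
and mesh independence of the lattice holonomy); Y. Hatsugai, J. Phys. Soc. Jpn. 75 (2006) 123601
(quantised Berry phase under an antiunitary symmetry, real gauge); T. Kato, *Perturbation Theory
for Linear Operators* (1966), II §5.1 (continuity of the eigenprojection of a simple eigenvalue,
here only through `uniform_overlap_of_isCompact`). No new definitions, no named facts.
-/

-- the mandated namespace `Summit.<Summit>.<Problem>.Theorems` repeats `HubbardSuperconductivity`
-- (single-problem summit, D-0017), which the `dupNamespace` linter flags on every declaration
set_option linter.dupNamespace false

namespace Summit.HubbardSuperconductivity.HubbardSuperconductivity.Theorems.NodalDiracTwist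

open Matrix Complex Literature.MathematicalPhysics.QuantumLattice HubbardWave0
open scoped ComplexOrder

/-! ### Two pieces of bookkeeping: fans of triangles, blocks of a refined loop -/

/-- **Fan of triangles.** For a symmetric real link function `Lk` and points `x 0, x 1, …`: if
`Lk (x 0) (x 0) > 0` and all the triangles `(x 0, x t, x (t+1))`, `t < k`, have positive link
product, then the "chord" link `Lk (x 0) (x k)` has the sign of the product of the `k` consecutive
links `Lk (x l) (x (l+1))`, `l < k` (induction on `k`: multiply by the next triangle and cancel the
square of the previous chord). Lattice Stokes argument for link variables, Fukui–Hatsugai–Suzuki,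
J. Phys. Soc. Jpn. 74 (2005) 1674. [folklore] -/
theorem prod_fan_pos {X : Type*} (Lk : X → X → ℝ) (hLsymm : ∀ a b, Lk b a = Lk a b) (x : ℕ → X)
    (h0 : 0 < Lk (x 0) (x 0)) :
    ∀ k : ℕ, (∀ t, t < k → 0 < Lk (x 0) (x t) * Lk (x t) (x (t + 1)) * Lk (x (t + 1)) (x 0)) →
      0 < Lk (x 0) (x k) * ∏ l ∈ Finset.range k, Lk (x l) (x (l + 1))
  | 0, _ => by simpa using h0
  | k + 1, htri => by
      have ih := prod_fan_pos Lk hLsymm x h0 k fun t ht => htri t (Nat.lt_succ_of_lt ht)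
      have h := mul_pos ih (htri k (Nat.lt_succ_self k))
      have key : Lk (x 0) (x k) * (∏ l ∈ Finset.range k, Lk (x l) (x (l + 1))) *
          (Lk (x 0) (x k) * Lk (x k) (x (k + 1)) * Lk (x (k + 1)) (x 0)) =
          Lk (x 0) (x (k + 1)) * ((∏ l ∈ Finset.range k, Lk (x l) (x (l + 1))) *
            Lk (x k) (x (k + 1))) * (Lk (x 0) (x k) * Lk (x 0) (x k)) := by
        rw [hLsymm (x 0) (x (k + 1))]
        ring
      rw [key] at h
      rw [Finset.prod_range_succ]
      exact pos_of_mul_pos_left h (mul_self_nonneg _)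

/-- Regrouping a product over `range (k * n)` into `n` consecutive blocks of length `k`:
`∏_{i < kn} g i = ∏_{j < n} ∏_{l < k} g (jk + l)`. [folklore] -/
theorem prod_range_mul_eq_prod_prod {M : Type*} [CommMonoid M] (g : ℕ → M) (k : ℕ) :
    ∀ n : ℕ, ∏ i ∈ Finset.range (k * n), g i =
      ∏ j ∈ Finset.range n, ∏ l ∈ Finset.range k, g (j * k + l)
  | 0 => by simp
  | n + 1 => by
      rw [mul_add_one, Finset.prod_range_add, prod_range_mul_eq_prod_prod g k n,
        Finset.prod_range_succ, Nat.mul_comm k n]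

/-- The coarse vertex `i` of the `n`-gon is the fine vertex `ik` of the `kn`-gon: the mesh angles
agree, `2π (ik)/(kn) = 2π i/n` (`k ≠ 0`). [folklore] -/
theorem angle_mul_eq (i k n : ℕ) (hk : (k : ℝ) ≠ 0) :
    2 * Real.pi * ((i * k : ℕ) : ℝ) / ((k * n : ℕ) : ℝ) = 2 * Real.pi * (i : ℝ) / (n : ℝ) := by
  push_cast
  rw [← mul_assoc, mul_comm (k : ℝ) n, mul_div_mul_right _ _ hk]

/-! ### The abstract coarsening theorem -/

section Abstract

variable {ι : Type*} [Fintype ι]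

/-- **Mesh coarsening of the `ℤ₂` holonomy on a circle (abstract form of `stub_meshCoarsening`).**
Let `H φ` be a continuous family of matrices acting on the sector `K`, with the variational lower
bound `hlb` and existence `hex` of sector ground states, and let `T` be an ANTIUNITARY operation
preserving `K` and commuting with every `H φ`. If the sector ground state (`GS`, literally the
shape of `IsGroundStateInSector`) is unique up to scalars on the circle `|φ - p| = r` (`r > 0`),
there is `n₀` such that for all `n ≥ n₀` and `k ≥ 1`: if for all unit ground-state choices on the
`kn`-gon `p + r (cos 2πi/kn, sin 2πi/kn)` the cyclic overlap product has negative real part, then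
so it has for all unit ground-state choices on the `n`-gon.
Proof: `T`-real unit sections `s` on the circle (`exists_unit_groundState_fixed`) have real,
symmetric links `ℓ`; `uniform_overlap_of_isCompact` (`ε = 1/10`) gives `δ`, and `n₀` is chosen with
`2πr/n₀ < δ`, so the `k + 1` fine vertices of each block (an arc of angular width `2π/n`) are
pairwise `δ`-close (`dist_polar_le`) and all triangles inside a block are positive
(`triangle_re_pos`); by `prod_fan_pos` each coarse link times the product of the fine links of its
block is positive, so `0 < C_n C_{kn}` for the real loop products (`prod_range_mul_eq_prod_prod`);
`C_{kn} < 0` is the hypothesis applied to the sections (`prod_finRotate_eq_prod_range`), hence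
`C_n < 0`, and arbitrary unit choices on the `n`-gon differ from the sections by unimodular phases
which cancel cyclically (`prod_star_smul_dotProduct_smul`). Mesh independence of the lattice
holonomy of a real line bundle, Fukui–Hatsugai–Suzuki, J. Phys. Soc. Jpn. 74 (2005) 1674;
Hatsugai, J. Phys. Soc. Jpn. 75 (2006) 123601. [folklore] -/
theorem re_prod_cyclicOverlap_neg_of_refinement (K : Submodule ℂ (ι → ℂ))
    (H : (Fin 2 → ℝ) → Matrix ι ι ℂ) (hH : Continuous H)
    (hlb : ∀ φ, ∀ v ∈ K, star v ⬝ᵥ v = 1 → (H φ).minEnergyOn K ≤ (star v ⬝ᵥ H φ *ᵥ v).re)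
    (hex : ∀ φ, ∃ v ∈ K, v ≠ 0 ∧ H φ *ᵥ v = (((H φ).minEnergyOn K : ℝ) : ℂ) • v)
    (GS : (Fin 2 → ℝ) → (ι → ℂ) → Prop)
    (hGS : ∀ φ χ, GS φ χ ↔ (χ ∈ K ∧ χ ≠ 0 ∧ H φ *ᵥ χ = (((H φ).minEnergyOn K : ℝ) : ℂ) • χ))
    (T : (ι → ℂ) → (ι → ℂ)) (hTs : ∀ (c : ℂ) (v : ι → ℂ), T (c • v) = star c • T v)
    (hTK : ∀ v ∈ K, T v ∈ K) (hTH : ∀ φ v, T (H φ *ᵥ v) = H φ *ᵥ T v)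
    (hTd : ∀ u v, star (T u) ⬝ᵥ T v = star (star u ⬝ᵥ v))
    (p : Fin 2 → ℝ) {r : ℝ} (hr : 0 < r)
    (huniq : ∀ φ : Fin 2 → ℝ, (φ 0 - p 0) ^ 2 + (φ 1 - p 1) ^ 2 = r ^ 2 →
      ∀ χ₁ χ₂ : ι → ℂ, GS φ χ₁ → GS φ χ₂ → ∃ z : ℂ, χ₂ = z • χ₁) :
    ∃ n₀ : ℕ, ∀ n ≥ n₀, ∀ k : ℕ, 0 < k →
      (∀ ψ : Fin (k * n) → ι → ℂ,
        (∀ i : Fin (k * n), GS (fun ν : Fin 2 => p ν + r * (if ν = 0 then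
            Real.cos (2 * Real.pi * (i : ℕ) / ((k * n : ℕ) : ℝ))
            else Real.sin (2 * Real.pi * (i : ℕ) / ((k * n : ℕ) : ℝ)))) (ψ i) ∧
          star (ψ i) ⬝ᵥ ψ i = 1) →
        (∏ i : Fin (k * n), star (ψ i) ⬝ᵥ ψ (finRotate (k * n) i)).re < 0) →
      ∀ ψ : Fin n → ι → ℂ,
        (∀ i : Fin n, GS (fun ν : Fin 2 => p ν + r * (if ν = 0 then
            Real.cos (2 * Real.pi * (i : ℕ) / n) else Real.sin (2 * Real.pi * (i : ℕ) / n))) (ψ i) ∧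
          star (ψ i) ⬝ᵥ ψ i = 1) →
        (∏ i : Fin n, star (ψ i) ⬝ᵥ ψ (finRotate n i)).re < 0 := by
  classical
  /- The circle `D`: a closed subset of the compact disk of radius `r`. -/
  set D : Set (Fin 2 → ℝ) := {φ | (φ 0 - p 0) ^ 2 + (φ 1 - p 1) ^ 2 = r ^ 2} with hD
  have hcont : Continuous fun φ : Fin 2 → ℝ => (φ 0 - p 0) ^ 2 + (φ 1 - p 1) ^ 2 := by fun_prop
  have hDcl : IsClosed D := isClosed_eq hcont continuous_const
  have hDc : IsCompact D := (isCompact_disk p hr.le).of_isClosed_subset hDcl fun φ hφ =>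
    (show (φ 0 - p 0) ^ 2 + (φ 1 - p 1) ^ 2 = r ^ 2 from hφ).le
  /- Step 0: `T`-real unit sections on the circle; their links are real. -/
  have huniq' : ∀ φ ∈ D, ∀ χ₁ χ₂ : ι → ℂ,
      (χ₁ ∈ K ∧ χ₁ ≠ 0 ∧ H φ *ᵥ χ₁ = (((H φ).minEnergyOn K : ℝ) : ℂ) • χ₁) →
      (χ₂ ∈ K ∧ χ₂ ≠ 0 ∧ H φ *ᵥ χ₂ = (((H φ).minEnergyOn K : ℝ) : ℂ) • χ₂) →
      ∃ z : ℂ, χ₂ = z • χ₁ :=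
    fun φ hφ χ₁ χ₂ h₁ h₂ => huniq φ hφ χ₁ χ₂ ((hGS _ _).2 h₁) ((hGS _ _).2 h₂)
  have hsec1 : ∀ φ : Fin 2 → ℝ, ∃ s : ι → ℂ, (φ ∈ D → GS φ s ∧ star s ⬝ᵥ s = 1 ∧ T s = s) := by
    intro φ
    by_cases hφ : φ ∈ D
    · obtain ⟨s, hs, hs1, hsT⟩ :=
        exists_unit_groundState_fixed K (H φ) (hex φ) T hTs hTK (hTH φ) hTd (huniq' φ hφ)
      exact ⟨s, fun _ => ⟨(hGS φ s).2 hs, hs1, hsT⟩⟩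
    · exact ⟨0, fun h => absurd h hφ⟩
  choose sec hsec using hsec1
  have hreal : ∀ φ φ', φ ∈ D → φ' ∈ D →
      star (sec φ) ⬝ᵥ sec φ' = (((star (sec φ) ⬝ᵥ sec φ').re : ℝ) : ℂ) := by
    intro φ φ' hφ hφ'
    have h := hTd (sec φ) (sec φ')
    rw [(hsec φ hφ).2.2, (hsec φ' hφ').2.2, Complex.star_def] at h
    exact (Complex.conj_eq_iff_re.1 h.symm).symm
  /- Step 1: uniform overlap `> 9/10` at scale `δ` on the compact circle. -/
  obtain ⟨δ, hδ0, hδ⟩ :=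
    uniform_overlap_of_isCompact K H hH hDc hlb huniq' (by norm_num : (0 : ℝ) < 1 / 10)
  have hov : ∀ φ φ', φ ∈ D → φ' ∈ D → dist φ φ' < δ →
      9 / 10 < ‖star (sec φ) ⬝ᵥ sec φ'‖ ^ 2 := by
    intro φ φ' hφ hφ' hd
    have h := hδ φ hφ φ' hφ' hd (sec φ) (sec φ') ((hGS _ _).1 (hsec φ hφ).1) (hsec φ hφ).2.1
      ((hGS _ _).1 (hsec φ' hφ').1) (hsec φ' hφ').2.1
    linarith
  /- Step 2: real link variables; triangles of nearby points are positive. -/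
  set Lk : (Fin 2 → ℝ) → (Fin 2 → ℝ) → ℝ := fun φ φ' => (star (sec φ) ⬝ᵥ sec φ').re with hLk
  have hLsymm : ∀ φ φ', Lk φ' φ = Lk φ φ' := fun φ φ' => star_dotProduct_comm_re (sec φ) (sec φ')
  have hLself : ∀ φ ∈ D, Lk φ φ = 1 := fun φ hφ => by
    change (star (sec φ) ⬝ᵥ sec φ).re = 1
    rw [(hsec φ hφ).2.1, Complex.one_re]
  have htri : ∀ a b c, a ∈ D → b ∈ D → c ∈ D →
      dist a b < δ → dist a c < δ → 0 < Lk a b * Lk b c * Lk c a := by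
    intro a b c ha hb hc hab hac
    have h := triangle_re_pos (hsec a ha).2.1 (hsec b hb).2.1 (hsec c hc).2.1
      (hov a b ha hb hab) (hov a c ha hc hac)
    rw [hreal a b ha hb, hreal b c hb hc, hreal c a hc ha, ← Complex.ofReal_mul,
      ← Complex.ofReal_mul, Complex.ofReal_re] at h
    exact h
  /- Step 3: the mesh threshold `2πr/n₀ < δ`; fix `n ≥ n₀`, `k ≥ 1`. -/
  refine ⟨⌈2 * Real.pi * r / δ⌉₊ + 1, ?_⟩
  intro n hn k hk hneg ψ hψ
  have hn0 : 0 < n := by omega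
  have hnR : (0 : ℝ) < n := by exact_mod_cast hn0
  have hkR : (0 : ℝ) < k := by exact_mod_cast hk
  have hrn : r * (2 * Real.pi / n) < δ := by
    have h1 : (⌈2 * Real.pi * r / δ⌉₊ : ℝ) < n := by
      exact_mod_cast Nat.lt_of_lt_of_le (Nat.lt_succ_self _) hn
    have h2 : 2 * Real.pi * r / δ < n := (Nat.le_ceil _).trans_lt h1
    rw [div_lt_iff₀ hδ0] at h2
    rw [show r * (2 * Real.pi / n) = 2 * Real.pi * r / n by ring, div_lt_iff₀ hnR]
    linarith
  have hkn0 : 0 < k * n := Nat.mul_pos hk hn0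
  have hM : ((k * n : ℕ) : ℝ) = (k : ℝ) * n := Nat.cast_mul k n
  have hMpos : (0 : ℝ) < ((k * n : ℕ) : ℝ) := by exact_mod_cast hkn0
  /- Step 4: the fine vertices `w j = p + r (cos 2πj/(kn), sin 2πj/(kn))`, `j : ℕ`. -/
  set w : ℕ → Fin 2 → ℝ := fun j ν => p ν + r *
    (if ν = 0 then Real.cos (2 * Real.pi * (j : ℝ) / ((k * n : ℕ) : ℝ))
      else Real.sin (2 * Real.pi * (j : ℝ) / ((k * n : ℕ) : ℝ))) with hw
  have hwD : ∀ j, w j ∈ D := fun j => polar_sq_eq p r _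
  have hθ : 2 * Real.pi * (k : ℝ) / ((k * n : ℕ) : ℝ) = 2 * Real.pi / n := by
    rw [hM, mul_comm (k : ℝ) (n : ℝ), mul_div_mul_right _ _ hkR.ne']
  have hdist : ∀ a t : ℕ, t ≤ k → dist (w a) (w (a + t)) < δ := by
    intro a t ht
    refine (dist_polar_le p hr.le le_rfl r (2 * Real.pi * (a : ℝ) / ((k * n : ℕ) : ℝ))
      (2 * Real.pi * ((a + t : ℕ) : ℝ) / ((k * n : ℕ) : ℝ))).trans_lt ?_
    have h1 : 2 * Real.pi * (a : ℝ) / ((k * n : ℕ) : ℝ) -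
        2 * Real.pi * ((a + t : ℕ) : ℝ) / ((k * n : ℕ) : ℝ) =
        -(2 * Real.pi * (t : ℝ) / ((k * n : ℕ) : ℝ)) := by
      rw [Nat.cast_add]
      ring
    rw [sub_self, abs_zero, add_zero, h1, abs_neg, abs_of_nonneg (by positivity)]
    have hle : 2 * Real.pi * (t : ℝ) / ((k * n : ℕ) : ℝ) ≤ 2 * Real.pi / n := by
      rw [← hθ]
      exact div_le_div_of_nonneg_right
        (mul_le_mul_of_nonneg_left (by exact_mod_cast ht) (by positivity)) hMpos.le
    exact (mul_le_mul_of_nonneg_left hle hr.le).trans_lt hrn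
  -- wrap-around of the fine index
  have hwper : w (k * n) = w 0 := by
    have h2 : 2 * Real.pi * ((k * n : ℕ) : ℝ) / ((k * n : ℕ) : ℝ) = 2 * Real.pi :=
      mul_div_cancel_right₀ _ hMpos.ne'
    funext ν
    simp only [hw, Nat.cast_zero, mul_zero, zero_div, Real.cos_zero, Real.sin_zero, h2,
      Real.cos_two_pi, Real.sin_two_pi]
  -- the coarse vertex `i` is the fine vertex `i * k`
  have hpt : ∀ i : Fin n, (fun ν : Fin 2 => p ν + r * (if ν = 0 then
      Real.cos (2 * Real.pi * (i : ℕ) / n) else Real.sin (2 * Real.pi * (i : ℕ) / n))) =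
      w ((i : ℕ) * k) := by
    intro i
    funext ν
    simp only [hw, angle_mul_eq _ _ _ hkR.ne']
  -- triangles inside a block are thin, hence positive
  have htri' : ∀ a t : ℕ, t < k → 0 < Lk (w (a + 0)) (w (a + t)) *
      Lk (w (a + t)) (w (a + (t + 1))) * Lk (w (a + (t + 1))) (w (a + 0)) := by
    intro a t ht
    rw [add_zero]
    have ha : w a = w (a + 0) := by rw [add_zero]
    refine htri _ _ _ (hwD _) (hwD _) (hwD _) ?_ ?_
    · rw [ha]
      exact hdist a t ht.le
    · rw [ha]
      exact hdist a (t + 1) (Nat.succ_le_of_lt ht)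
  /- Step 5: the real links `f a b` of fine vertices; blocks; the loop products. -/
  set f : ℕ → ℕ → ℝ := fun a b => Lk (w a) (w b) with hf
  have hblock : ∀ j : ℕ, 0 < f (j * k) ((j + 1) * k) *
      ∏ l ∈ Finset.range k, f (j * k + l) (j * k + l + 1) := by
    intro j
    have h0 : 0 < Lk (w (j * k + 0)) (w (j * k + 0)) := by
      rw [hLself _ (hwD _)]
      exact one_pos
    have h := prod_fan_pos Lk hLsymm (fun l => w (j * k + l)) h0 k (htri' (j * k))
    simpa only [hf, add_zero, add_assoc, add_one_mul] using h
  -- fine loop product `Cf = C_{kn}`, coarse loop product `Cc = C_n`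
  set Cf : ℝ := ∏ i ∈ Finset.range (k * n), f i (i + 1) with hCf
  set Cc : ℝ := ∏ j ∈ Finset.range n, f (j * k) ((j + 1) * k) with hCc
  have hCC : 0 < Cc * Cf := by
    have h : Cc * Cf = ∏ j ∈ Finset.range n, (f (j * k) ((j + 1) * k) *
        ∏ l ∈ Finset.range k, f (j * k + l) (j * k + l + 1)) := by
      rw [Finset.prod_mul_distrib, hCf, prod_range_mul_eq_prod_prod (fun i => f i (i + 1)) k n]
    rw [h]
    exact Finset.prod_pos fun j _ => hblock j
  /- Step 6: the fine loop: `Cf < 0` by hypothesis, applied to the sections themselves. -/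
  have hCf0 : Cf < 0 := by
    have hGSw : ∀ i : Fin (k * n), GS (fun ν : Fin 2 => p ν + r * (if ν = 0 then
        Real.cos (2 * Real.pi * (i : ℕ) / ((k * n : ℕ) : ℝ))
        else Real.sin (2 * Real.pi * (i : ℕ) / ((k * n : ℕ) : ℝ)))) (sec (w i)) ∧
        star (sec (w i)) ⬝ᵥ sec (w i) = 1 := fun i =>
      ⟨(hsec _ (hwD i)).1, (hsec _ (hwD i)).2.1⟩
    have h : (∏ i : Fin (k * n), star (sec (w i)) ⬝ᵥ sec (w (finRotate (k * n) i))).re < 0 :=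
      hneg (fun i => sec (w i)) hGSw
    have hconv : ∏ i : Fin (k * n), star (sec (w i)) ⬝ᵥ sec (w (finRotate (k * n) i)) =
        ∏ i ∈ Finset.range (k * n), star (sec (w i)) ⬝ᵥ sec (w (i + 1)) :=
      BridgeNodalToDWave.prod_finRotate_eq_prod_range hkn0 (fun j => sec (w j))
        (congrArg sec hwper)
    have hCfsec : ∏ i ∈ Finset.range (k * n), star (sec (w i)) ⬝ᵥ sec (w (i + 1)) =
        ((Cf : ℝ) : ℂ) := by
      rw [hCf, Complex.ofReal_prod]
      refine Finset.prod_congr rfl fun i _ => ?_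
      rw [hreal _ _ (hwD i) (hwD (i + 1))]
    rwa [hconv, hCfsec, Complex.ofReal_re] at h
  /- Step 7: the coarse loop: arbitrary unit ground states differ from the sections by phases. -/
  have hψ' : ∀ i : Fin n, GS (w ((i : ℕ) * k)) (ψ i) ∧ star (ψ i) ⬝ᵥ ψ i = 1 := fun i => by
    rw [← hpt i]
    exact hψ i
  have hz : ∀ i : Fin n, ∃ z : ℂ, ψ i = z • sec (w ((i : ℕ) * k)) := fun i =>
    huniq (w ((i : ℕ) * k)) (hwD _) (sec (w ((i : ℕ) * k))) (ψ i) (hsec _ (hwD _)).1 (hψ' i).1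
  choose z hz using hz
  have hz1 : ∀ i, ‖z i‖ = 1 := fun i => by
    have h := (hψ' i).2
    rw [hz i] at h
    exact norm_eq_one_of_unit_smul (hsec _ (hwD _)).2.1 h
  have hconv' : ∏ i : Fin n, star (sec (w ((i : ℕ) * k))) ⬝ᵥ
      sec (w (((finRotate n i : Fin n) : ℕ) * k)) =
      ∏ j ∈ Finset.range n, star (sec (w (j * k))) ⬝ᵥ sec (w ((j + 1) * k)) :=
    BridgeNodalToDWave.prod_finRotate_eq_prod_range hn0 (fun j => sec (w (j * k)))
      (by
        show sec (w (n * k)) = sec (w (0 * k))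
        rw [Nat.mul_comm n k, hwper, zero_mul])
  have hprod : ∏ i : Fin n, star (ψ i) ⬝ᵥ ψ (finRotate n i) = ((Cc : ℝ) : ℂ) := by
    have h1 : ∏ i : Fin n, star (ψ i) ⬝ᵥ ψ (finRotate n i) =
        ∏ i : Fin n, star (z i • sec (w ((i : ℕ) * k))) ⬝ᵥ
          (z (finRotate n i) • sec (w (((finRotate n i : Fin n) : ℕ) * k))) := by
      refine Finset.prod_congr rfl fun i _ => ?_
      rw [← hz i, ← hz (finRotate n i)]
    rw [h1, prod_star_smul_dotProduct_smul (finRotate n) z hz1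
      (fun i : Fin n => sec (w ((i : ℕ) * k))), hconv', hCc, Complex.ofReal_prod]
    refine Finset.prod_congr rfl fun j _ => ?_
    rw [hreal _ _ (hwD _) (hwD _)]
  rw [hprod, Complex.ofReal_re]
  exact neg_of_mul_pos_left hCC hCf0.le

end Abstract

/-! ### The spin-twisted torus -/

section Twisted

/-- **`stub_meshCoarsening`** (line `birth` of crux stmt-HubbardSuperconductivity-10370,
`NodalDiracWeakCoupling`; mesh independence of the `ℤ₂` holonomy on a circle, for the tree's
`spinTwistedHubbardTorus`). For any `L, U, N`, centre `p` and radius `r > 0`: if the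
`(N, S^z = 0)`-sector ground state of `H_L(U, φ) = spinTwistedHubbardTorus L U φ` is unique up to
scalars at every point of the circle `|φ - p| = r`, there is `n₀` such that for all `n ≥ n₀` and
all `k ≥ 1`: if the cyclic overlap products of all unit ground-state choices on the `kn`-gon
`p + r (cos 2πi/kn, sin 2πi/kn)` have negative real part, so do those on the `n`-gon. The abstract
`re_prod_cyclicOverlap_neg_of_refinement` with `K = szSector N 0` (a coordinate sector, so
`sector_groundState` supplies existence and the variational bound; if the sector is empty there
are no ground states and the claim is vacuous) and the antiunitary `T v = F v̄`, `F` the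
spin-exchange unitary, exactly as in `annulusInvariance_twisted`. Fukui–Hatsugai–Suzuki, J. Phys.
Soc. Jpn. 74 (2005) 1674; Hatsugai, J. Phys. Soc. Jpn. 75 (2006) 123601. [folklore] -/
theorem stub_meshCoarsening :
    ∀ (L : ℕ) [NeZero L] (U : ℝ) (N : ℕ) (p : Fin 2 → ℝ) (r : ℝ), 0 < r →
      (∀ φ : Fin 2 → ℝ, (φ 0 - p 0) ^ 2 + (φ 1 - p 1) ^ 2 = r ^ 2 →
        ∀ χ₁ χ₂ : Fock (Orb (FermionTorus 2 L)),
          IsGroundStateInSector (spinTwistedHubbardTorus L U φ) N 0 χ₁ →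
          IsGroundStateInSector (spinTwistedHubbardTorus L U φ) N 0 χ₂ → ∃ z : ℂ, χ₂ = z • χ₁) →
      ∃ n₀ : ℕ, ∀ n ≥ n₀, ∀ k : ℕ, 0 < k →
        (∀ ψ : Fin (k * n) → Fock (Orb (FermionTorus 2 L)),
          (∀ i : Fin (k * n),
            IsGroundStateInSector (spinTwistedHubbardTorus L U
                (fun ν : Fin 2 => p ν + r *
                      (if ν = 0 then Real.cos (2 * Real.pi * (i : ℕ) / ((k * n : ℕ) : ℝ))
                        else Real.sin (2 * Real.pi * (i : ℕ) / ((k * n : ℕ) : ℝ))))) N 0 (ψ i) ∧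
              star (ψ i) ⬝ᵥ ψ i = 1) →
          (∏ i : Fin (k * n), star (ψ i) ⬝ᵥ ψ (finRotate (k * n) i)).re < 0) →
        ∀ ψ : Fin n → Fock (Orb (FermionTorus 2 L)),
          (∀ i : Fin n,
            IsGroundStateInSector (spinTwistedHubbardTorus L U
                (fun ν : Fin 2 => p ν + r *
                      (if ν = 0 then Real.cos (2 * Real.pi * (i : ℕ) / n)
                        else Real.sin (2 * Real.pi * (i : ℕ) / n)))) N 0 (ψ i) ∧
              star (ψ i) ⬝ᵥ ψ i = 1) →
          (∏ i : Fin n, star (ψ i) ⬝ᵥ ψ (finRotate n i)).re < 0 := by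
  intro L _ U N p r hr huniq
  classical
  by_cases hp : ∃ s : Finset (Orb (FermionTorus 2 L)),
      s.card = N ∧ (upPart s).card = (downPart s).card
  · have hsg := fun φ : Fin 2 → ℝ => sector_groundState (spinTwistedHubbardTorus L U φ)
      (spinTwistedHubbardTorus_isHermitian L U φ)
      (fun s : Finset (Orb (FermionTorus 2 L)) => s.card = N ∧ (upPart s).card = (downPart s).card)
      hp (fun s s' hs hs' => spinTwistedHubbardTorus_apply_eq_zero L U φ N s s' hs hs')
      (szSector N 0) (mem_szSector_zero_iff_coord N)
    set F := (fockRelabel (Orb.spinSwap : Orb (FermionTorus 2 L) ≃ Orb (FermionTorus 2 L))).val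
      with hF
    have hTs : ∀ (c : ℂ) (v : Fock (Orb (FermionTorus 2 L))),
        F *ᵥ star (c • v) = star c • (F *ᵥ star v) := fun c v => by
      rw [star_smul, mulVec_smul]
    have hTK : ∀ v ∈ szSector N (0 : ℝ), F *ᵥ star v ∈ szSector N (0 : ℝ) := fun v hv =>
      fockRelabel_spinSwap_mulVec_mem_szSector (NodalDiracTwist.star_mem_szSector hv)
    have hTH : ∀ (φ : Fin 2 → ℝ) (v : Fock (Orb (FermionTorus 2 L))),
        F *ᵥ star (spinTwistedHubbardTorus L U φ *ᵥ v) =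
          spinTwistedHubbardTorus L U φ *ᵥ (F *ᵥ star v) := fun φ v =>
      fockRelabel_spinSwap_mulVec_star_mulVec L U φ v
    have hTd : ∀ u v : Fock (Orb (FermionTorus 2 L)),
        star (F *ᵥ star u) ⬝ᵥ (F *ᵥ star v) = star (star u ⬝ᵥ v) := fun u v => by
      rw [hF, star_fockRelabel_mulVec_dotProduct_fockRelabel_mulVec, star_star, dotProduct_star,
        dotProduct_comm]
    exact re_prod_cyclicOverlap_neg_of_refinement (szSector N 0) (spinTwistedHubbardTorus L U)
      (continuous_spinTwistedHubbardTorus L U) (fun φ => (hsg φ).2) (fun φ => (hsg φ).1)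
      (fun φ χ => IsGroundStateInSector (spinTwistedHubbardTorus L U φ) N 0 χ)
      (fun _ _ => Iff.rfl) (fun v => F *ᵥ star v) hTs hTK hTH hTd p hr huniq
  · -- the sector is empty: there are no ground states at all
    push Not at hp
    refine ⟨1, fun n hn k _ _ ψ hψ => ?_⟩
    obtain ⟨hmem, hne, -⟩ := (hψ ⟨0, by omega⟩).1
    exact (hne (funext fun s =>
      (mem_szSector_zero_iff_coord N _).1 hmem s fun h => hp s h.1 h.2)).elim

end Twisted

end Summit.HubbardSuperconductivity.HubbardSuperconductivity.Theorems.NodalDiracTwist
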